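import Mathlib
import Literature.NumberTheory.LFunctions.WeilExplicit
import HarnessLib

/-!
# Window test functions `g(t) = e^{t/2} ψ(t)` for the smoothed explicit formula

Helper file 2/3 for item stmt-RiemannHypothesis-24919 `ZetaIntegerPrimeConsistent` (route
`DensityLadder`, LINE L57 «sieve sight above the density line», K2).

For the short multiplicative window `n ∈ x(1 ± η)` the line's test function is
`g(t) = e^{t/2} φ((e^t/x − 1)/η)` in the additive variable `t = log n` of the tree's Weil
normalisation (`Literature.NumberTheory.LFunctions.weilMellin`).  This file computes the three
sides of the explicit formula for such `g`:
* `ĝ(s) = η x^s ∫_{-1}^{1} φ(v)(1+ηv)^{s−1} dv` (change of variables `e^t = x(1+ηv)`);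
* the prime term is `Σ_n Λ(n) ψ(log n)` (`g(−log n) = 0`);
* Bombieri's archimedean term is `O(sup|ψ| · |window|)` and `ĝ(0) = O(sup|φ|)`, uniformly in
  `0 < η ≤ 1/2` (on the window `e^t/(2 sinh t) ≤ 9/5`).
Cell rh-split, seat rh-split-prover-l57 g0.  RH-free.  Nothing here bears on the truth of RH.
-/

set_option linter.dupNamespace false

noncomputable section

open Complex Filter Set MeasureTheory Topology
open scoped Real ComplexConjugate

namespace Summit.RiemannHypothesis.RiemannHypothesis.Theorems.DensityLadderWindowTestFunction

open Literature.NumberTheory.LFunctions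

/-! ## Window test functions `g(t) = e^{t/2} ψ(t)` -/

section Window

/-- `ĝ(s) = ∫ ψ(t) e^{st} dt` for `g(t) = e^{t/2} ψ(t)`. [folklore] -/
theorem weilMellin_expHalf_mul (ψ : ℝ → ℝ) (s : ℂ) :
    weilMellin (fun t : ℝ ↦ ((Real.exp (t / 2) * ψ t : ℝ) : ℂ)) s =
      ∫ t : ℝ, (ψ t : ℂ) * cexp (s * t) := by
  unfold weilMellin
  congr 1 with t
  have h : cexp ((s - 1 / 2) * t) = cexp (s * t) * cexp (-(t / 2 : ℂ)) := by
    rw [← Complex.exp_add]; congr 1; ring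
  rw [h]
  push_cast
  have h2 : cexp ((t : ℂ) / 2) * cexp (-(t / 2 : ℂ)) = 1 := by
    rw [← Complex.exp_add]; simp
  calc cexp ((t : ℂ) / 2) * (ψ t : ℂ) * (cexp (s * t) * cexp (-(t / 2 : ℂ)))
      = (ψ t : ℂ) * cexp (s * t) * (cexp ((t : ℂ) / 2) * cexp (-(t / 2 : ℂ))) := by ring
    _ = (ψ t : ℂ) * cexp (s * t) := by rw [h2, mul_one]

/-- **Change of variables `e^t = x(1 + ηv)`**: for `φ` continuous vanishing off `(-1, 1)`,
`0 < η ≤ 1/2`, `0 < x`, and every `s`,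
`∫ φ((e^t/x − 1)/η) e^{st} dt = η x^s ∫_{-1}^{1} φ(v) (1 + ηv)^{s-1} dv`. [folklore] -/
theorem integral_window_cexp (φ : ℝ → ℝ) (hφc : Continuous φ) (hφs : ∀ v, 1 ≤ |v| → φ v = 0)
    {η x : ℝ} (hη : 0 < η) (hη1 : η ≤ 1 / 2) (hx : 0 < x) (s : ℂ) :
    ∫ t : ℝ, (φ ((Real.exp t / x - 1) / η) : ℂ) * cexp (s * t) =
      η * (x : ℂ) ^ s * ∫ v in (-1 : ℝ)..1, (φ v : ℂ) * ((1 : ℂ) + (η : ℂ) * (v : ℂ)) ^ (s - 1) := by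
  -- the substitution `t = f v = log (x (1 + η v))`, `f' v = η / (1 + η v)`
  set G : ℝ → ℂ := fun t ↦ (φ ((Real.exp t / x - 1) / η) : ℂ) * cexp (s * t) with hG
  set f : ℝ → ℝ := fun v ↦ Real.log (x * (1 + η * v)) with hf
  set f' : ℝ → ℝ := fun v ↦ η / (1 + η * v) with hf'
  have hpos : ∀ v ∈ uIcc (-1 : ℝ) 1, 0 < 1 + η * v := by
    intro v hv
    rw [uIcc_of_le (by norm_num), mem_Icc] at hv
    nlinarith
  have hGc : Continuous G := by
    have : Continuous fun t : ℝ ↦ (Real.exp t / x - 1) / η := by fun_prop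
    exact (Complex.continuous_ofReal.comp (hφc.comp this)).mul (by fun_prop)
  have hderiv : ∀ v ∈ uIcc (-1 : ℝ) 1, HasDerivAt f (f' v) v := by
    intro v hv
    have h0 := hpos v hv
    have h1 : HasDerivAt (fun v : ℝ ↦ x * (1 + η * v)) (x * η) v := by
      have := ((hasDerivAt_id v).const_mul η).const_add 1 |>.const_mul x
      simpa using this
    have h2 := h1.log (by positivity)
    convert h2 using 1
    rw [hf']
    field_simp
  have hf'c : ContinuousOn f' (uIcc (-1 : ℝ) 1) := by
    refine ContinuousOn.div continuousOn_const (by fun_prop) fun v hv ↦ (hpos v hv).ne'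
  -- change of variables
  have hcv := intervalIntegral.integral_deriv_smul_comp hderiv hf'c hGc
  -- the support of `G` lies in `(f(-1), f(1)]`
  have hsupp : Function.support G ⊆ Ioc (f (-1)) (f 1) := by
    intro t ht
    rw [Function.mem_support] at ht
    have hφ : φ ((Real.exp t / x - 1) / η) ≠ 0 := by
      intro h; apply ht; simp [hG, h]
    have hlt : |(Real.exp t / x - 1) / η| < 1 := by
      by_contra h; exact hφ (hφs _ (not_lt.1 h))
    rw [abs_lt, lt_div_iff₀ hη, div_lt_iff₀ hη] at hlt
    have het : 0 < Real.exp t := Real.exp_pos t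
    have h1 : x * (1 + η * (-1)) < Real.exp t := by
      have := hlt.1; rw [lt_sub_iff_add_lt, lt_div_iff₀ hx] at this; linarith
    have h2 : Real.exp t < x * (1 + η * 1) := by
      have := hlt.2; rw [sub_lt_iff_lt_add, div_lt_iff₀ hx] at this; linarith
    refine ⟨?_, ?_⟩
    · rw [hf]
      calc Real.log (x * (1 + η * (-1))) < Real.log (Real.exp t) :=
            Real.log_lt_log (by nlinarith) h1
        _ = t := Real.log_exp t
    · rw [hf]
      calc t = Real.log (Real.exp t) := (Real.log_exp t).symm
        _ ≤ Real.log (x * (1 + η * 1)) := (Real.log_lt_log het h2).le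
  rw [← intervalIntegral.integral_eq_integral_of_support_subset hsupp, ← hcv,
    ← intervalIntegral.integral_const_mul]
  refine intervalIntegral.integral_congr fun v hv ↦ ?_
  have h0 := hpos v hv
  have hx1 : 0 < x * (1 + η * v) := by positivity
  simp only [Function.comp_apply, hG, hf, hf', Complex.real_smul]
  have e1 : (Real.exp (Real.log (x * (1 + η * v))) / x - 1) / η = v := by
    rw [Real.exp_log hx1]; field_simp; ring
  have e2 : cexp (s * ((Real.log (x * (1 + η * v)) : ℝ) : ℂ)) =
      (x : ℂ) ^ s * (((1 + η * v : ℝ) : ℂ)) ^ s := by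
    rw [Complex.ofReal_log hx1.le, mul_comm, ← Complex.cpow_def_of_ne_zero
      (by exact_mod_cast hx1.ne'), Complex.ofReal_mul,
      Complex.mul_cpow_ofReal_nonneg hx.le h0.le]
  rw [e1, e2]
  have hne : ((1 + η * v : ℝ) : ℂ) ≠ 0 := by exact_mod_cast h0.ne'
  have hb : ((1 : ℂ) + (η : ℂ) * (v : ℂ)) = ((1 + η * v : ℝ) : ℂ) := by push_cast; ring
  have e3 : ((1 : ℂ) + (η : ℂ) * (v : ℂ)) ^ (s - 1) =
      (((1 + η * v : ℝ) : ℂ)) ^ s / ((1 + η * v : ℝ) : ℂ) := by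
    rw [hb, Complex.cpow_sub _ _ hne, Complex.cpow_one]
  rw [e3, Complex.ofReal_div]
  field_simp

end Window

/-! ## The three sides for a window `ψ` supported in `(0, ∞)` -/

section Sides

/-- For `g(t) = e^{t/2} ψ(t)` with `ψ = 0` on `(-∞, 0]`, the prime term is `Σ_n Λ(n) ψ(log n)`
(`e^{(log n)/2} = √n` cancels `n^{-1/2}`, and `g(−log n) = 0`). [folklore] -/
theorem weilPrimeTerm_expHalf_mul (ψ : ℝ → ℝ) (hψ0 : ∀ t, t ≤ 0 → ψ t = 0) :
    weilPrimeTerm (fun t : ℝ ↦ ((Real.exp (t / 2) * ψ t : ℝ) : ℂ)) =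
      ∑' n : ℕ, ((ArithmeticFunction.vonMangoldt n * ψ (Real.log n) : ℝ) : ℂ) := by
  unfold weilPrimeTerm
  refine tsum_congr fun n ↦ ?_
  rcases Nat.eq_zero_or_pos n with hn | hn
  · subst hn; simp
  · have hn' : (0 : ℝ) < n := by exact_mod_cast hn
    have hlog : 0 ≤ Real.log n := Real.log_nonneg (by exact_mod_cast hn)
    have h1 : ψ (-Real.log n) = 0 := hψ0 _ (by linarith)
    have h2 : Real.exp (Real.log n / 2) = Real.sqrt n := by
      rw [Real.sqrt_eq_rpow, Real.rpow_def_of_pos hn']; ring_nf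
    have hsq : (Real.sqrt n : ℂ) ≠ 0 := by
      exact_mod_cast (Real.sqrt_pos.2 hn').ne'
    beta_reduce
    rw [h1, mul_zero, h2]
    push_cast
    field_simp
    ring

/-- For `g(t) = e^{t/2} ψ(t)` with `ψ = 0` on `(-∞, 0]`: `g(0) = 0`. [folklore] -/
theorem expHalf_mul_apply_zero (ψ : ℝ → ℝ) (hψ0 : ∀ t, t ≤ 0 → ψ t = 0) :
    (fun t : ℝ ↦ ((Real.exp (t / 2) * ψ t : ℝ) : ℂ)) 0 = 0 := by
  simp [hψ0 0 le_rfl]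

/-- **Bombieri's archimedean term of a window test function is `O(1)`**: if `ψ` is continuous,
`|ψ| ≤ M`, and `ψ(t) ≠ 0` only for `t ∈ [a, b]` with `log(3/2) ≤ a ≤ b`, then for
`g(t) = e^{t/2} ψ(t)` one has `‖W_∞^B(g)‖ ≤ (9/5) M (b − a)` (on the window
`e^t / (2 sinh t) = 1/(1 − e^{−2t}) ≤ 9/5`). [folklore] -/
theorem norm_weilArchTermBombieri_expHalf_mul_le (ψ : ℝ → ℝ) {a b M : ℝ}
    (ha : Real.log (3 / 2) ≤ a) (hab : a ≤ b) (hM : ∀ t, |ψ t| ≤ M)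
    (hψs : ∀ t, ψ t ≠ 0 → t ∈ Icc a b) :
    ‖weilArchTermBombieri (fun t : ℝ ↦ ((Real.exp (t / 2) * ψ t : ℝ) : ℂ))‖ ≤
      9 / 5 * M * (b - a) := by
  have hM0 : 0 ≤ M := (abs_nonneg _).trans (hM 0)
  have ha0 : 0 < a := lt_of_lt_of_le (Real.log_pos (by norm_num)) ha
  have hψ0 : ∀ t, t ≤ 0 → ψ t = 0 := by
    intro t ht; by_contra h; have := (hψs t h).1; linarith
  set g : ℝ → ℂ := fun t : ℝ ↦ ((Real.exp (t / 2) * ψ t : ℝ) : ℂ) with hg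
  have hg0 : g 0 = 0 := by simp [hg, hψ0 0 le_rfl]
  have hgneg : ∀ t, 0 < t → g (-t) = 0 := fun t ht ↦ by simp [hg, hψ0 (-t) (by linarith)]
  rw [weilArchTermBombieri, hg0, mul_zero, zero_add, norm_neg]
  -- pointwise bound on `Ioi 0`
  set B : ℝ → ℝ := (Icc a b).indicator fun _ ↦ 9 / 5 * M with hB
  have hBint : Integrable B (volume.restrict (Ioi (0 : ℝ))) :=
    ((integrable_indicator_iff measurableSet_Icc).2
      (by rw [integrableOn_const_iff]; right; rw [Real.volume_Icc]; exact ENNReal.ofReal_lt_top)).restrict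
  have hbound : ∀ᵐ t ∂(volume.restrict (Ioi (0 : ℝ))),
      ‖((Real.exp (t / 2) : ℂ) * (g t + g (-t)) - 2 * 0) / (2 * Real.sinh t : ℂ)‖ ≤ B t := by
    rw [ae_restrict_iff' measurableSet_Ioi]
    refine Eventually.of_forall fun t (ht : 0 < t) ↦ ?_
    rw [hgneg t ht, add_zero, mul_zero, sub_zero]
    by_cases hψt : ψ t = 0
    · have : g t = 0 := by simp [hg, hψt]
      rw [this, mul_zero, zero_div, norm_zero, hB]
      exact Set.indicator_nonneg (fun _ _ ↦ by positivity) _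
    · have htab := hψs t hψt
      rw [hB, indicator_of_mem htab]
      have hsinh : 0 < Real.sinh t := Real.sinh_pos_iff.2 ht
      have hexp2 : 9 / 4 ≤ Real.exp (2 * t) := by
        have h1 : Real.exp (2 * Real.log (3 / 2)) = 9 / 4 := by
          rw [mul_comm, Real.exp_mul, Real.exp_log (by norm_num)]; norm_num
        rw [← h1]; exact Real.exp_le_exp.2 (by linarith [htab.1])
      -- `e^t ≤ (9/5) · 2 sinh t`
      have hkey : Real.exp t ≤ 9 / 5 * (2 * Real.sinh t) := by
        rw [Real.sinh_eq]
        have e2 : Real.exp (2 * t) = Real.exp t * Real.exp t := by rw [two_mul, Real.exp_add]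
        have e3 : Real.exp t * Real.exp (-t) = 1 := by rw [← Real.exp_add]; simp
        nlinarith [Real.exp_pos t, Real.exp_pos (-t)]
      have hnum : ‖((Real.exp (t / 2) : ℂ) * g t)‖ = Real.exp t * |ψ t| := by
        simp only [hg]
        rw [norm_mul, Complex.norm_real, Complex.norm_real, Real.norm_eq_abs, Real.norm_eq_abs,
          abs_mul, abs_of_pos (Real.exp_pos _)]
        have : Real.exp (t / 2) * Real.exp (t / 2) = Real.exp t := by
          rw [← Real.exp_add]; ring_nf
        calc Real.exp (t / 2) * (Real.exp (t / 2) * |ψ t|)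
            = (Real.exp (t / 2) * Real.exp (t / 2)) * |ψ t| := by ring
          _ = Real.exp t * |ψ t| := by rw [this]
      have hden : ‖(2 * Real.sinh t : ℂ)‖ = 2 * Real.sinh t := by
        rw [show (2 * Real.sinh t : ℂ) = ((2 * Real.sinh t : ℝ) : ℂ) by push_cast; ring,
          Complex.norm_real, Real.norm_eq_abs, abs_of_pos (by positivity)]
      rw [norm_div, hnum, hden, div_le_iff₀ (by positivity)]
      calc Real.exp t * |ψ t| ≤ (9 / 5 * (2 * Real.sinh t)) * M :=
            mul_le_mul hkey (hM t) (abs_nonneg _) (by positivity)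
        _ = 9 / 5 * M * (2 * Real.sinh t) := by ring
  refine (norm_integral_le_of_norm_le hBint hbound).trans ?_
  have hBnn : 0 ≤ᵐ[volume] B := Eventually.of_forall fun t ↦
    Set.indicator_nonneg (fun _ _ ↦ by positivity) _
  have hBint' : Integrable B volume :=
    (integrable_indicator_iff measurableSet_Icc).2
      (by rw [integrableOn_const_iff]; right; rw [Real.volume_Icc]; exact ENNReal.ofReal_lt_top)
  refine (setIntegral_le_integral hBint' hBnn).trans ?_
  rw [hB, integral_indicator_const _ measurableSet_Icc, Real.volume_real_Icc_of_le hab,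
    smul_eq_mul]
  nlinarith

/-- **The polar value `ĝ(0)` of a window test function is `O(1)`**: for `φ` continuous with
`|φ| ≤ M`, `0 < η ≤ 1/2`, `0 < x`,
`‖η x^0 ∫_{-1}^{1} φ(v)(1+ηv)^{-1} dv‖ ≤ 2M`. [folklore] -/
theorem norm_polarZero_window_le (φ : ℝ → ℝ) {M : ℝ} (hM : ∀ v, |φ v| ≤ M)
    {η : ℝ} (x : ℝ) (hη : 0 < η) (hη1 : η ≤ 1 / 2) :
    ‖(η : ℂ) * (x : ℂ) ^ (0 : ℂ) * ∫ v in (-1 : ℝ)..1, (φ v : ℂ) *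
        ((1 : ℂ) + (η : ℂ) * (v : ℂ)) ^ ((0 : ℂ) - 1)‖ ≤ 2 * M := by
  have hM0 : 0 ≤ M := (abs_nonneg _).trans (hM 0)
  rw [Complex.cpow_zero, mul_one, norm_mul, Complex.norm_real, Real.norm_eq_abs, abs_of_pos hη]
  have hint : ‖∫ v in (-1 : ℝ)..1, (φ v : ℂ) * ((1 : ℂ) + (η : ℂ) * (v : ℂ)) ^ ((0 : ℂ) - 1)‖ ≤
      2 * M * |1 - (-1)| := by
    refine intervalIntegral.norm_integral_le_of_norm_le_const fun v hv ↦ ?_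
    rw [uIoc_of_le (by norm_num), mem_Ioc] at hv
    have hpos : 0 < 1 + η * v := by nlinarith
    have hb : ((1 : ℂ) + (η : ℂ) * (v : ℂ)) = ((1 + η * v : ℝ) : ℂ) := by push_cast; ring
    rw [zero_sub, hb, Complex.cpow_neg_one, norm_mul, Complex.norm_real, norm_inv,
      Complex.norm_real, Real.norm_eq_abs, Real.norm_eq_abs, abs_of_pos hpos]
    have h2 : (1 + η * v)⁻¹ ≤ 2 := by
      rw [inv_le_comm₀ hpos (by norm_num)]; nlinarith
    calc |φ v| * (1 + η * v)⁻¹ ≤ M * 2 := mul_le_mul (hM v) h2 (by positivity) hM0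
      _ = 2 * M := by ring
  calc η * ‖∫ v in (-1 : ℝ)..1, (φ v : ℂ) * ((1 : ℂ) + (η : ℂ) * (v : ℂ)) ^ ((0 : ℂ) - 1)‖
      ≤ (1 / 2) * (2 * M * |1 - (-1)|) := mul_le_mul hη1 hint (norm_nonneg _) (by norm_num)
    _ = 2 * M := by norm_num; ring

end Sides

end Summit.RiemannHypothesis.RiemannHypothesis.Theorems.DensityLadderWindowTestFunction

end
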